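import Summits.BirchSwinnertonDyer.Rank1Residual.ManinAdditive.ShimuraExponentAtTwoSieve
import HarnessLib

/-!
# The Shimura exponent at 2 — discharge of the Eisenstein inputs BY NAME (cell bsd-f2-manin, es g42; MEMO-es §64)

The rows files `Rank1Residual/ManinAdditive/ShimuraExponentAtTwo(.Sieve).lean` state their theorems modulo
`hO : EsG42.OddLevelEisensteinAtTwo`, `hE : EsG42.EvenLevelEisensteinAtTwo`; both are tree theorems VERBATIM
(`ManinLocalTwoThree.ShimuraIndexAtTwo.oddLevelEisensteinAtTwo` / `evenLevelEisensteinAtTwo`,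
`Theorems/ManinLocalTwoThreeShimuraIndexAtTwoExponent.lean`).  This file supplies them, making UNCONDITIONAL:
E-es-218 (E-es-193m ⟺ R4♯ ∧ R5♯); E-es-214 (prime-level Derickx–Orlić rung on `q ≢ 1 (8)`, `q ≢ 1 (5)`); E-es-215/216/217
(index-5 / index-3 / nine-level profiles); E-es-219 (R4♯ at odd `N = u²v`, `4 ∤ φ(uv)/2`); and E-es-213 ⟸ `exists_isNewformOf` alone.
Route `ManinLocalTwoThree`, crux C2 stmt-BirchSwinnertonDyer-22967 (helper).  HONEST FRAMING: C2, C3, the Derickx–Orlić question in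
general, Manin's conjecture and BSD are NOT proved here.
[cite: LingOesterle1991, Thm. 1 and Thm. 6] [cite: AtkinLehner1970, Thm. 3] [cite: DerickxOrlic2025, Rmk. 4.8]
-/

set_option autoImplicit false
-- lint-debt: the directory name repeats the summit name (sibling precedent `ManinLocalTwoThreeShimuraIndexAtTwo.lean`)
set_option linter.dupNamespace false

noncomputable section

open scoped MatrixGroups ModularForm

open CongruenceSubgroup Complex WeierstrassCurve Literature.NumberTheory.EllipticCurves
  Literature.NumberTheory.EllipticCurves.ModularForms
open Summit.BirchSwinnertonDyer.Rank1Residual.ManinAdditive.KatoCurve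
open Summit.BirchSwinnertonDyer.Rank1Residual.ManinAdditive.EsG42

namespace Summit.BirchSwinnertonDyer.BirchSwinnertonDyer.Theorems.ManinLocalTwoThree.ShimuraExponentAtTwo

/-- The odd-level Eisenstein input holds (tree theorem, by name). [cite: LingOesterle1991, Thm. 6] -/
theorem oddLevelEisensteinAtTwo_holds : OddLevelEisensteinAtTwo :=
  fun W _ _ _ _ f hf hN ↦ ShimuraIndexAtTwo.oddLevelEisensteinAtTwo W f hf hN

/-- The even-level Eisenstein input holds (tree theorem, by name). [cite: LingOesterle1991, Thm. 6] [cite: AtkinLehner1970, Thm. 3] -/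
theorem evenLevelEisensteinAtTwo_holds : EvenLevelEisensteinAtTwo :=
  fun f hf hN ↦ ShimuraIndexAtTwo.evenLevelEisensteinAtTwo f hf hN

/-- **E-es-218 UNCONDITIONAL: E-es-193m ⟺ R4♯ ∧ R5♯.** [cite: LingOesterle1991, Thm. 6] [cite: DerickxOrlic2025, Rmk. 4.8] -/
theorem derickxOrlicIffOddLaws_holds : DerickxOrlicIffOddLaws :=
  derickxOrlicIffOddLaws_of oddLevelEisensteinAtTwo_holds evenLevelEisensteinAtTwo_holds

/-- **E-es-214 UNCONDITIONAL**: the prime-level Derickx–Orlić rung on the primes `q ≢ 1 (mod 8)`, `q ≢ 1 (mod 5)`.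
[cite: LingOesterle1991, Thm. 1 and Thm. 6] [cite: DerickxOrlic2025, Rmk. 4.8] -/
theorem primeLevelShimuraExponentLeThreeSieved_holds : PrimeLevelShimuraExponentLeThreeSieved :=
  primeLevelShimuraExponentLeThreeSieved_of oddLevelEisensteinAtTwo_holds

/-- E-es-215 UNCONDITIONAL. [cite: LingOesterle1991, Thm. 1 and Thm. 6] -/
theorem fiveIndexProfile_holds : FiveIndexProfile :=
  fiveIndexProfile_of oddLevelEisensteinAtTwo_holds evenLevelEisensteinAtTwo_holds

/-- E-es-216 UNCONDITIONAL. [cite: LingOesterle1991, Thm. 1 and Thm. 6] -/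
theorem threeIndexProfile_holds : ThreeIndexProfile :=
  threeIndexProfile_of oddLevelEisensteinAtTwo_holds evenLevelEisensteinAtTwo_holds

/-- E-es-217 UNCONDITIONAL (the additive prime `3`). [cite: LingOesterle1991, Thm. 6] [cite: AtkinLehner1970, Thm. 3] -/
theorem nineLevelShimuraProfile_holds : NineLevelShimuraProfile :=
  nineLevelShimuraProfile_of oddLevelEisensteinAtTwo_holds evenLevelEisensteinAtTwo_holds

/-- E-es-219 UNCONDITIONAL: R4♯ at odd `N = u²v` with `4 ∤ φ(uv)/2`. [cite: LingOesterle1991, Thm. 1 and Thm. 6] -/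
theorem halfTotientSievedNoFourTorsion_holds : HalfTotientSievedNoFourTorsion :=
  halfTotientSievedNoFourTorsion_of oddLevelEisensteinAtTwo_holds

/-- E-es-213 (Stein–Watkins degree list) ⟸ modularity alone. [cite: SteinWatkins2002] -/
theorem steinWatkinsDegreeList_holds_of_modularity (hnf : exists_isNewformOf) : SteinWatkinsDegreeList :=
  steinWatkinsDegreeList_of_modularity hnf oddLevelEisensteinAtTwo_holds evenLevelEisensteinAtTwo_holds

end Summit.BirchSwinnertonDyer.BirchSwinnertonDyer.Theorems.ManinLocalTwoThree.ShimuraExponentAtTwo
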